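import Mathlib.Analysis.SpecialFunctions.Trigonometric.Inverse
import Literature.Analysis.FluidPDE.NSAnalyticityRadiusLinfty
import Literature.Analysis.FluidPDE.Vorticity
import Literature.Analysis.FluidPDE.ClassicalSolution
import HarnessLib

/-!
# A geometric measure-type regularity criterion: local linear sparseness of the super-level sets
# at the scale of the analyticity radius (Grujić 2013, Definition 4.1, Theorems 4.1 and 4.2)

Topic `Analysis/FluidPDE`. Source: Z. Grujić, *A geometric measure-type regularity criterion for
solutions to the 3D Navier–Stokes equations*, Nonlinearity **26** (2013) 289–296 = arXiv:1111.0217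
[Grujic2012] (held, lit key `paper:arxiv-1111.0217`; read: §2 (harmonic measure, Solynin's theorem
= Thm. 2.1), §3 (Thm. 3.1 = the `L^∞` analyticity estimate of Guberović 2010, in the tree
`guberovic2010_analyticity_radius` / `guberovic2010_analyticity_radius_holds`
(`NSAnalyticityRadiusLinfty*.lean`); Thm. 3.2 its vorticity version), §4 (**Definition 4.1**,
**Theorem 4.1** with its proof, Remark 4.1, **Theorem 4.2**), §5 (epilogue: the scale of sparseness
`‖ω‖_∞^{-1/2}` versus Constantin's a-priori `L¹` bound)). This is the first paper of the
"sparseness / scaling gap" line (Bradshaw–Farhat–Grujić 2019 [BradshawFarhatGrujic2018], Grujić–Xu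
[GrujicXu2024], Grujić 2026 [Grujic2026]) cited by several NavierStokesRegularity theses
(`SelfMixingDichotomy`, `ComplexTouchdown`); no decl stated it (`lean search
'sparse|Sparse|linearlySparse|Grujic2012'` in `Literature/Analysis`, 2026-08-26: the analyticity
estimate only).

No regularity claim about Navier–Stokes is made by this file beyond the printed theorems, recorded
as named facts (`def … : Prop`, cite-tagged, unproved here), with the printed Definition 4.1 and the
exponent `h(δ)` as definitions carrying small proved API lemmas.

## What is printed (arXiv:1111.0217, §4, verbatim up to notation; `ν = 1`)

**Definition 4.1.** "Let `x₀` be a point in `ℝ³`, `r > 0`, `S` an open subset of `ℝ³` and `δ` in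
`(0, 1)`. The set `S` is *linearly `δ`-sparse around `x₀` at scale `r` in weak sense* if there
exists a unit vector `d` in `S²` such that `|S ∩ (x₀ − rd, x₀ + rd)|/(2r) ≤ δ`."
"For `M > 0`, denote by `Ω_t(M)` the super-level set at time `t`; more precisely,
`Ω_t(M) = {x ∈ ℝ³ : |u(x, t)| > M}`."

**Theorem 4.1.** "Suppose that a solution `u` is regular on an interval `(0, T*)`. (Recall that `u`
is then necessarily in `C((0, T*); L^∞)`.) Assume that either
(i) there exists `t` in `(0, T*)` such that `t + 1/(c₀²‖u(t)‖_∞²) ≥ T*` (`c₀` is the constant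
featured in Theorem 3.1), or
(ii) `t + 1/(c₀²‖u(t)‖_∞²) < T*` for all `t` in `(0, T*)`, and there exists `ε` in `(0, T*)` such
that for any `t` in `(T* − ε, T*)`, there exists `s = s(t)` in
`[t + 1/(4c₀²‖u(t)‖_∞²), t + 1/(c₀²‖u(t)‖_∞²)]` with the property that for any spatial point `x₀`,
there exists a scale `r = r(x₀)`, `0 < r ≤ 1/(2c₀²‖u(t)‖_∞)`, such that the super-level set
`Ω_s(M)` is linearly `δ`-sparse around `x₀` at scale `r` in weak sense; here, `δ = δ(x₀)` is an
arbitrary value in `(0, 1)`, `h = h(δ) = (2/π) arcsin((1 − δ²)/(1 + δ²))`, `α = α(δ) ≥ (1 − h)/h`,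
and `M = M(δ) = c₀^{−α}‖u(t)‖_∞`.
Then, there exists `γ > 0` such that `u` is in `L^∞((T* − ε, T* + γ); L^∞)`, i.e., `T*` is not a
singular time." **Remark 4.1.** "It is plain from the proof that it is enough to assume the
condition on a finitely many suitably chosen times."

**Theorem 3.1** (the constant `c₀`). "Let `u₀` be in `L^∞(ℝ³)`. Then, there exists an absolute
constant `c₀ > 1` such that setting `T = 1/(c₀²‖u₀‖_∞²)`, a unique mild solution `u = u(t)` on
`[0, T]` has the analytic extension `U = U(t)` to the region `𝓡_t = {x + iy ∈ ℂ³ : |y| ≤ c₀⁻¹√t}`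
for any `t` in `(0, T]`. In addition, `‖U(t)‖_{L^∞(𝓡_t)} ≤ c₀‖u₀‖_∞` for all `t` in `[0, T]`."
**Theorem 3.2** (the constant `d₀`): the same for the vorticity, "Let `ω₀` be in `L^∞(ℝ³)` …
`T = 1/(d₀²‖ω₀‖_∞)` … analytic extension `Ω = Ω(t)` to `𝓡_t = {… |y| ≤ d₀⁻¹√t}` …
`‖Ω(t)‖_{L^∞(𝓡_t)} ≤ d₀‖ω₀‖_∞`."

**Theorem 4.2** (vorticity version, p. 8): as Theorem 4.1 with `Ω^ω_t(M) = {x : |ω(x,t)| > M}`,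
`ω = curl u`, the constant `d₀` of Theorem 3.2, the window
`s ∈ [t + 1/(4d₀²‖ω(t)‖_∞), t + 1/(d₀²‖ω(t)‖_∞)]`, the scales `0 < r ≤ 1/(2d₀²‖ω(t)‖_∞^{1/2})`,
`M = d₀^{−α}‖ω(t)‖_∞`, and the conclusion "`ω` is in `L^∞((T* − ε, T* + γ); L^∞)`, i.e., `T*`
is not a singular time."

## Transcription into the tree's vocabulary

* `ℝ³ = EuclideanSpace ℝ (Fin 3)`, time first; viscosity `ν > 0` by the scaling
  `v(x, s) = ν⁻¹ u(x, s/ν)` (a viscosity-`ν` solution ↦ a viscosity-`1` one): Theorem 3.1's window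
  becomes `ν/(c₀²‖u(t)‖_∞²)` and its radius `c₀⁻¹√(ν(s − t))` (exactly the tree's
  `guberovic2010_analyticity_radius`), so in (ii) `s ∈ [t + ν/(4c₀²‖u(t)‖_∞²), t + ν/(c₀²‖u(t)‖_∞²)]`
  and `r ≤ ν/(2c₀²‖u(t)‖_∞)`; for the vorticity the window `1/(d₀²‖ω(t)‖_∞)` is `ν`-free and
  `r ≤ √ν/(2d₀²‖ω(t)‖_∞^{1/2})`.
* "a solution `u` regular on `(0, T*)`": a classical unforced solution
  `IsClassicalNSSolutionOn (Ioo 0 T) ν 0 u p` with bounded slices; `‖u(t)‖_∞ = ⨆ x, ‖u t x‖`.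
* "`c₀` is the constant featured in Theorem 3.1": the proof of Theorem 4.1 uses the Navier–Stokes
  equations ONLY through Theorem 3.1 restarted at the times `t₀, s₀ = t₁, s₁, …` (analytic
  extension of `u(s)` to the tube of radius `c₀⁻¹√(ν(s − t))` with the bound `c₀‖u(t)‖_∞`, for
  `t < s < t + ν/(c₀²‖u(t)‖_∞²)`) and through the translation/rotation invariance of that
  property; we therefore take `c₀ > 1` as a parameter and this restart property of `u` as an
  explicit hypothesis (`Grujic2013.HasAnalyticRestarts c₀ ν T u`). For the mild solution of the
  printed class it is supplied, with Guberović's absolute `c₀`, by the tree theorem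
  `guberovic2010_analyticity_radius_holds` and `L^∞` mild uniqueness — so the fact below is the
  printed theorem with its appeal to Theorem 3.1 made explicit, not a stronger statement. The
  vorticity version takes `d₀` and `Grujic2013.HasVorticityAnalyticRestarts d₀ ν T u` likewise
  (Theorem 3.2 is stated in the source with "the proof is analogous"; it is not in the tree).
* Only alternative (ii) is recorded (alternative (i) is Theorem 3.1 itself restarted at `t`).
  `ε ∈ (0, T*)` is a parameter; the printed conclusion "`u ∈ L^∞((T* − ε, T* + γ); L^∞)` for some
  `γ > 0`" is recorded as boundedness up to `T*`: `sup_{T*−ε<t<T*} ‖u(t)‖_∞ < ∞` (the extension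
  past `T*` is then Theorem 3.1 once more; for the vorticity version, boundedness of `ω` up to
  `T*`).
* Definition 4.1: `Grujic2013.IsLinearlySparseAround S x₀ r δ` with the one-dimensional Lebesgue
  measure of `{τ ∈ (−r, r) : x₀ + τd ∈ S}` for a unit vector `d` (the printed
  `|S ∩ (x₀ − rd, x₀ + rd)|`); openness of `S` is not needed for the definition.
* `h(δ) = (2/π) arcsin((1 − δ²)/(1 + δ²))` is `Grujic2013.solyninExponent δ` (`∈ (0, 1)` for
  `δ ∈ (0, 1)`, proved); "`α ≥ (1 − h)/h`" is an existentially chosen `α` with that bound, and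
  `c₀^{−α}‖u(t)‖_∞` is `‖u(t)‖_∞ / c₀ ^ α` (real power).

## References

* Z. Grujić, Nonlinearity 26 (2013) 289–296 = arXiv:1111.0217: Def. 4.1, Thm. 4.1, Rmk. 4.1,
  Thm. 4.2 (pp. 7–8 of the arXiv version), Thms. 3.1–3.2 and Rmks. 3.1–3.2 (p. 6), §5 (p. 9).
  [Grujic2012]
* R. Guberović, Discrete Contin. Dyn. Syst. 27 (2010) 231–236 (Theorem 3.1 of the source; tree
  `guberovic2010_analyticity_radius`). [Guberovic2010]
* A. Yu. Solynin, Zap. Nauchn. Sem. POMI 1997 / J. Math. Sci. 1999 (Theorem 2.1 of the source, the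
  extremal harmonic-measure estimate behind `h(δ)`).
* Z. Bradshaw, A. Farhat, Z. Grujić, Arch. Ration. Mech. Anal. 231 (2019) 1983–2005 (the
  successor "scaling gap" criterion). [BradshawFarhatGrujic2018]
-/

noncomputable section

open MeasureTheory Set Function Filter Metric
open scoped ENNReal
open Literature.Analysis.FunctionSpaces.EuclideanSpace (complexify)

namespace Literature.Analysis.FluidPDE

namespace Grujic2013

/-- **Grujić 2013, Definition 4.1 (linear `δ`-sparseness around a point at scale `r`, weak
sense).** A set `S ⊆ ℝ³` is linearly `δ`-sparse around `x₀` at scale `r` if for some unit vector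
`d` the portion of the segment `(x₀ − rd, x₀ + rd)` lying in `S` has one-dimensional measure at
most `δ · 2r`: `|{τ ∈ (−r, r) : x₀ + τ d ∈ S}| ≤ 2rδ` ("there exists a unit vector `d` in `S²` such
that `|S ∩ (x₀ − rd, x₀ + rd)|/(2r) ≤ δ`"). Printed for open `S`, `r > 0`, `δ ∈ (0, 1)`.
[cite: Grujic2012, Def. 4.1 (arXiv:1111.0217, p. 7)] -/
def IsLinearlySparseAround (S : Set (EuclideanSpace ℝ (Fin 3))) (x₀ : EuclideanSpace ℝ (Fin 3))
    (r δ : ℝ) : Prop :=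
  ∃ d : EuclideanSpace ℝ (Fin 3), ‖d‖ = 1 ∧
    volume {τ : ℝ | τ ∈ Ioo (-r) r ∧ x₀ + τ • d ∈ S} ≤ ENNReal.ofReal (2 * r * δ)

/-- Unfolding Definition 4.1. [cite: Grujic2012, Def. 4.1 (arXiv:1111.0217, p. 7)] -/
theorem isLinearlySparseAround_iff {S : Set (EuclideanSpace ℝ (Fin 3))}
    {x₀ : EuclideanSpace ℝ (Fin 3)} {r δ : ℝ} :
    IsLinearlySparseAround S x₀ r δ ↔
      ∃ d : EuclideanSpace ℝ (Fin 3), ‖d‖ = 1 ∧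
        volume {τ : ℝ | τ ∈ Ioo (-r) r ∧ x₀ + τ • d ∈ S} ≤ ENNReal.ofReal (2 * r * δ) :=
  Iff.rfl

/-- Sparseness is inherited by subsets and survives enlarging `δ` (monotonicity of the measure;
Definition 4.1). [cite: Grujic2012, Def. 4.1 (arXiv:1111.0217, p. 7)] -/
theorem IsLinearlySparseAround.mono {S S' : Set (EuclideanSpace ℝ (Fin 3))}
    {x₀ : EuclideanSpace ℝ (Fin 3)} {r δ δ' : ℝ} (h : IsLinearlySparseAround S x₀ r δ)
    (hS : S' ⊆ S) (hr : 0 ≤ r) (hδ : δ ≤ δ') : IsLinearlySparseAround S' x₀ r δ' := by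
  obtain ⟨d, hd, hvol⟩ := h
  have hsub : {τ : ℝ | τ ∈ Ioo (-r) r ∧ x₀ + τ • d ∈ S'} ⊆
      {τ : ℝ | τ ∈ Ioo (-r) r ∧ x₀ + τ • d ∈ S} := fun τ hτ => ⟨hτ.1, hS hτ.2⟩
  refine ⟨d, hd, (measure_mono hsub).trans (hvol.trans ?_)⟩
  exact ENNReal.ofReal_le_ofReal (by nlinarith)

/-- Every set is linearly `δ`-sparse at scale `r` for `δ ≥ 1` (the segment has measure `2r`):
the definition only bites for `δ < 1`, as printed. [cite: Grujic2012, Def. 4.1 (arXiv:1111.0217, p. 7)] -/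
theorem isLinearlySparseAround_of_one_le {S : Set (EuclideanSpace ℝ (Fin 3))}
    {x₀ : EuclideanSpace ℝ (Fin 3)} {r δ : ℝ} (hr : 0 ≤ r) (hδ : 1 ≤ δ) :
    IsLinearlySparseAround S x₀ r δ := by
  refine ⟨EuclideanSpace.single 0 1, by simp, ?_⟩
  calc volume {τ : ℝ | τ ∈ Ioo (-r) r ∧ x₀ + τ • EuclideanSpace.single 0 (1 : ℝ) ∈ S}
      ≤ volume (Ioo (-r) r) := measure_mono fun τ hτ => hτ.1
    _ = ENNReal.ofReal (2 * r) := by rw [Real.volume_Ioo]; ring_nf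
    _ ≤ ENNReal.ofReal (2 * r * δ) := ENNReal.ofReal_le_ofReal (by nlinarith)

/-- **Solynin's exponent** `h(δ) = (2/π) arcsin((1 − δ²)/(1 + δ²))` of Theorem 4.1: the lower
bound for the harmonic measure at the centre of the unit disc of a closed subset of the diameter
of length `2(1 − δ)` (Solynin 1999 = Theorem 2.1 of the source, with `λ = 1 − δ`).
[cite: Grujic2012, Thm. 2.1 (p. 5) and Thm. 4.1 (p. 7) (arXiv:1111.0217)] -/
def solyninExponent (δ : ℝ) : ℝ :=
  2 / Real.pi * Real.arcsin ((1 - δ ^ 2) / (1 + δ ^ 2))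

/-- Unfolding `h(δ)`. [cite: Grujic2012, Thm. 4.1 (arXiv:1111.0217, p. 7)] -/
theorem solyninExponent_def (δ : ℝ) :
    solyninExponent δ = 2 / Real.pi * Real.arcsin ((1 - δ ^ 2) / (1 + δ ^ 2)) :=
  rfl

/-- For `δ ∈ (0, 1)` the exponent `h(δ)` lies in `(0, 1)` (the argument of `arcsin` lies in
`(0, 1)`), so that `(1 − h)/h > 0` and the threshold `M = c₀^{−α}‖u(t)‖_∞`, `α ≥ (1 − h)/h`, is a
genuine fraction of `‖u(t)‖_∞`. [cite: Grujic2012, Thm. 4.1 (arXiv:1111.0217, p. 7)] -/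
theorem solyninExponent_mem_Ioo {δ : ℝ} (hδ0 : 0 < δ) (hδ1 : δ < 1) :
    solyninExponent δ ∈ Ioo (0 : ℝ) 1 := by
  have hδ2 : δ ^ 2 < 1 := by nlinarith
  have hpos : 0 < (1 - δ ^ 2) / (1 + δ ^ 2) := div_pos (by linarith) (by positivity)
  have hlt : (1 - δ ^ 2) / (1 + δ ^ 2) < 1 := by
    rw [div_lt_one (by positivity)]
    nlinarith
  have h1 : 0 < Real.arcsin ((1 - δ ^ 2) / (1 + δ ^ 2)) := Real.arcsin_pos.2 hpos
  have h2 : Real.arcsin ((1 - δ ^ 2) / (1 + δ ^ 2)) < Real.pi / 2 :=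
    Real.arcsin_lt_pi_div_two.2 hlt
  have hπ : 0 < Real.pi := Real.pi_pos
  refine ⟨by unfold solyninExponent; positivity, ?_⟩
  unfold solyninExponent
  rw [div_mul_eq_mul_div, div_lt_one hπ]
  linarith

/-- **The restart form of Theorem 3.1 as a property of the solution `u` on `(0, T)`** ("`c₀` is the
constant featured in Theorem 3.1", used in the proof of Theorem 4.1 at the restart times
`t₀, s₀, s₁, …`): for every `t ∈ (0, T)` and every later time `s < T` inside the window
`s < t + ν/(c₀²‖u(t)‖_∞²)`, the slice `u(s)` has a complex-analytic extension `U` to the open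
tube of radius `c₀⁻¹√(ν(s − t))` (`complexTube`) with `U(x) = u(s, x)` on the real points and
`‖U‖ ≤ c₀‖u(t)‖_∞` on the tube. For the mild solution from bounded data this holds with Guberović's
absolute constant (`guberovic2010_analyticity_radius`).
[cite: Grujic2012, Thm. 3.1 and Rmk. 3.1 (arXiv:1111.0217, p. 6); proof of Thm. 4.1 (p. 7)] -/
def HasAnalyticRestarts (c₀ ν T : ℝ)
    (u : ℝ → EuclideanSpace ℝ (Fin 3) → EuclideanSpace ℝ (Fin 3)) : Prop :=
  ∀ t ∈ Ioo 0 T, ∀ s ∈ Ioo t T, s < t + ν / (c₀ ^ 2 * (⨆ x, ‖u t x‖) ^ 2) →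
    ∃ U : EuclideanSpace ℂ (Fin 3) → EuclideanSpace ℂ (Fin 3),
      DifferentiableOn ℂ U (complexTube (Fin 3) (c₀⁻¹ * Real.sqrt (ν * (s - t)))) ∧
      (∀ x : EuclideanSpace ℝ (Fin 3), U (complexify x) = complexify (u s x)) ∧
      ∀ z ∈ complexTube (Fin 3) (c₀⁻¹ * Real.sqrt (ν * (s - t))), ‖U z‖ ≤ c₀ * ⨆ x, ‖u t x‖

/-- **The restart form of Theorem 3.2 (vorticity) as a property of `u` on `(0, T)`**: for every
`t ∈ (0, T)` and `s ∈ (t, T)` with `s < t + 1/(d₀²‖ω(t)‖_∞)`, `ω = curl u`, the slice `ω(s)` has a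
complex-analytic extension to the tube of radius `d₀⁻¹√(ν(s − t))` agreeing with `ω(s)` on the real
points and bounded there by `d₀‖ω(t)‖_∞`.
[cite: Grujic2012, Thm. 3.2 (arXiv:1111.0217, p. 6); Thm. 4.2 (p. 8)] -/
def HasVorticityAnalyticRestarts (d₀ ν T : ℝ)
    (u : ℝ → EuclideanSpace ℝ (Fin 3) → EuclideanSpace ℝ (Fin 3)) : Prop :=
  ∀ t ∈ Ioo 0 T, ∀ s ∈ Ioo t T, s < t + 1 / (d₀ ^ 2 * ⨆ x, ‖curl (u t) x‖) →
    ∃ W : EuclideanSpace ℂ (Fin 3) → EuclideanSpace ℂ (Fin 3),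
      DifferentiableOn ℂ W (complexTube (Fin 3) (d₀⁻¹ * Real.sqrt (ν * (s - t)))) ∧
      (∀ x : EuclideanSpace ℝ (Fin 3), W (complexify x) = complexify (curl (u s) x)) ∧
      ∀ z ∈ complexTube (Fin 3) (d₀⁻¹ * Real.sqrt (ν * (s - t))), ‖W z‖ ≤ d₀ * ⨆ x, ‖curl (u t) x‖

end Grujic2013

/-- **Grujić 2013, Theorem 4.1 (alternative (ii)): local linear sparseness of the velocity
super-level sets at the scale of the analyticity radius prevents blow-up.** Let `c₀ > 1`, `ν > 0`,
`0 < ε < T`, and let `(u, p)` be a classical unforced Navier–Stokes solution on `ℝ³ × (0, T)` with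
bounded slices, `N(t) = ‖u(t)‖_∞`, enjoying the restart form of the `L^∞` analyticity estimate with
constant `c₀` (`Grujic2013.HasAnalyticRestarts c₀ ν T u`; for mild solutions: Guberović 2010 =
Theorem 3.1 of the source). Assume (ii): `t + ν/(c₀²N(t)²) < T` for all `t ∈ (0, T)`, and for every
`t ∈ (T − ε, T)` there is a time `s ∈ [t + ν/(4c₀²N(t)²), t + ν/(c₀²N(t)²)]` such that for every
point `x₀` there are `δ ∈ (0, 1)`, `α ≥ (1 − h(δ))/h(δ)` (`h = Grujic2013.solyninExponent`) and a
scale `0 < r ≤ ν/(2c₀²N(t))` for which the super-level set `Ω_s(M) = {x : |u(x, s)| > M}`,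
`M = c₀^{−α}N(t)`, is linearly `δ`-sparse around `x₀` at scale `r`
(`Grujic2013.IsLinearlySparseAround`). Then `T` is not a singular time: `‖u(t)‖_∞` stays bounded on
`(T − ε, T)`. Printed with `ν = 1` and the conclusion `u ∈ L^∞((T* − ε, T* + γ); L^∞)`; see the
module docstring for the transcription. Not proved here; users take
`(h : grujic2013_sparseness_regularity_velocity)`.
[cite: Grujic2012, Thm. 4.1 (ii) with Def. 4.1 and Thm. 3.1 (arXiv:1111.0217, pp. 6–8)] -/
def grujic2013_sparseness_regularity_velocity : Prop :=
  ∀ ⦃c₀ ν T ε : ℝ⦄, 1 < c₀ → 0 < ν → 0 < ε → ε < T →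
    ∀ ⦃u : ℝ → EuclideanSpace ℝ (Fin 3) → EuclideanSpace ℝ (Fin 3)⦄
      ⦃p : ℝ → EuclideanSpace ℝ (Fin 3) → ℝ⦄,
    IsClassicalNSSolutionOn (Ioo 0 T) ν 0 u p →
    (∀ t ∈ Ioo 0 T, BddAbove (Set.range fun x => ‖u t x‖)) →
    Grujic2013.HasAnalyticRestarts c₀ ν T u →
    -- (ii), first clause: the analyticity window from any `t < T` closes before `T`
    (∀ t ∈ Ioo 0 T, t + ν / (c₀ ^ 2 * (⨆ x, ‖u t x‖) ^ 2) < T) →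
    -- (ii), second clause: sparseness of the super-level sets at a later time in the window
    (∀ t ∈ Ioo (T - ε) T,
      ∃ s ∈ Icc (t + ν / (4 * c₀ ^ 2 * (⨆ x, ‖u t x‖) ^ 2)) (t + ν / (c₀ ^ 2 * (⨆ x, ‖u t x‖) ^ 2)),
        ∀ x₀ : EuclideanSpace ℝ (Fin 3), ∃ δ ∈ Ioo (0 : ℝ) 1, ∃ α : ℝ,
          (1 - Grujic2013.solyninExponent δ) / Grujic2013.solyninExponent δ ≤ α ∧
          ∃ r : ℝ, 0 < r ∧ r ≤ ν / (2 * c₀ ^ 2 * ⨆ x, ‖u t x‖) ∧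
            Grujic2013.IsLinearlySparseAround {x | (⨆ y, ‖u t y‖) / c₀ ^ α < ‖u s x‖} x₀ r δ) →
    -- `T` is not a singular time: `u` stays bounded on `(T - ε, T) × ℝ³`
    ∃ B : ℝ, ∀ t ∈ Ioo (T - ε) T, ∀ x : EuclideanSpace ℝ (Fin 3), ‖u t x‖ ≤ B

/-- **Grujić 2013, Theorem 4.2 (alternative (ii), vorticity version): local linear sparseness of
the vorticity super-level sets at the scale `‖ω‖_∞^{-1/2}` prevents blow-up.** Let `d₀ > 1`,
`ν > 0`, `0 < ε < T`, and let `(u, p)` be a classical unforced Navier–Stokes solution on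
`ℝ³ × (0, T)` with bounded vorticity slices, `ω = curl u`, `Nω(t) = ‖ω(t)‖_∞`, enjoying the restart
form of the vorticity analyticity estimate with constant `d₀`
(`Grujic2013.HasVorticityAnalyticRestarts d₀ ν T u`, Theorem 3.2 of the source). Assume (ii):
`t + 1/(d₀²Nω(t)) < T` for all `t ∈ (0, T)`, and for every `t ∈ (T − ε, T)` there is
`s ∈ [t + 1/(4d₀²Nω(t)), t + 1/(d₀²Nω(t))]` such that for every `x₀` there are `δ ∈ (0, 1)`,
`α ≥ (1 − h(δ))/h(δ)` and a scale `0 < r ≤ √ν/(2d₀²Nω(t)^{1/2})` for which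
`Ω^ω_s(M) = {x : |ω(x, s)| > M}`, `M = d₀^{−α}Nω(t)`, is linearly `δ`-sparse around `x₀` at scale
`r`. Then `T` is not a singular time: `‖ω(t)‖_∞` stays bounded on `(T − ε, T)`. Printed with
`ν = 1` and the conclusion `ω ∈ L^∞((T* − ε, T* + γ); L^∞)`. Not proved here; users take
`(h : grujic2013_sparseness_regularity_vorticity)`.
[cite: Grujic2012, Thm. 4.2 (ii) with Def. 4.1 and Thm. 3.2 (arXiv:1111.0217, pp. 6–8)] -/
def grujic2013_sparseness_regularity_vorticity : Prop :=
  ∀ ⦃d₀ ν T ε : ℝ⦄, 1 < d₀ → 0 < ν → 0 < ε → ε < T →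
    ∀ ⦃u : ℝ → EuclideanSpace ℝ (Fin 3) → EuclideanSpace ℝ (Fin 3)⦄
      ⦃p : ℝ → EuclideanSpace ℝ (Fin 3) → ℝ⦄,
    IsClassicalNSSolutionOn (Ioo 0 T) ν 0 u p →
    (∀ t ∈ Ioo 0 T, BddAbove (Set.range fun x => ‖curl (u t) x‖)) →
    Grujic2013.HasVorticityAnalyticRestarts d₀ ν T u →
    (∀ t ∈ Ioo 0 T, t + 1 / (d₀ ^ 2 * ⨆ x, ‖curl (u t) x‖) < T) →
    (∀ t ∈ Ioo (T - ε) T,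
      ∃ s ∈ Icc (t + 1 / (4 * d₀ ^ 2 * ⨆ x, ‖curl (u t) x‖)) (t + 1 / (d₀ ^ 2 * ⨆ x, ‖curl (u t) x‖)),
        ∀ x₀ : EuclideanSpace ℝ (Fin 3), ∃ δ ∈ Ioo (0 : ℝ) 1, ∃ α : ℝ,
          (1 - Grujic2013.solyninExponent δ) / Grujic2013.solyninExponent δ ≤ α ∧
          ∃ r : ℝ, 0 < r ∧ r ≤ Real.sqrt ν / (2 * d₀ ^ 2 * Real.sqrt (⨆ x, ‖curl (u t) x‖)) ∧
            Grujic2013.IsLinearlySparseAround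
              {x | (⨆ y, ‖curl (u t) y‖) / d₀ ^ α < ‖curl (u s) x‖} x₀ r δ) →
    ∃ B : ℝ, ∀ t ∈ Ioo (T - ε) T, ∀ x : EuclideanSpace ℝ (Fin 3), ‖curl (u t) x‖ ≤ B

end Literature.Analysis.FluidPDE

end
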